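import Literature.Analysis.FunctionSpaces.TorusH1DistanceBounds
import Literature.Analysis.FunctionSpaces.TorusClassicalNSUniqueness
import Literature.Analysis.FunctionSpaces.TorusTruncationH1
import Literature.Analysis.FluidPDE.TorusClassicalLerayHopfProofs
import Literature.Analysis.FluidPDE.NSUniqueness2DParts
import HarnessLib

/-!
# Limits of `H¹`-Cauchy sequences of smooth fields on `T^d`: elementary tools for the
# construction of strong Navier–Stokes solutions from `V`-data by smooth approximation

Analysis/FluidPDE proof file (theorems only; no definitions, no named facts). Small lemmas used by
`TorusNSVDataExistence*` (Robinson–Rodrigo–Sadowski 2016, Thm 6.8 with Thm 7.5: strong solutions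
from `u₀ ∈ V` as limits of the solutions issued from the Galerkin truncations `P_N u₀`):
two smooth `L²`-limits of one sequence coincide (`Torus.eq_of_tendsto_integral_norm_sub_sq`); a
pairwise `H¹` bound passes to a smooth `H¹`-limit of a subsequence (`Torus.h1DistSq_le_of_tendsto`);
an enstrophy bound passes to `H¹`-limits (`Torus.gradNormSq_le_of_tendsto`, via the weighted
parallelogram bound `Torus.mul_gradNormSq_add_le`); parallelogram bound for weighted Fourier sums of
a difference (`Torus.sum_mul_norm_sq_mFourierCoeff_sub_le`); Gevrey levels of real trigonometric
polynomials over frequency balls are bounded by one finite sum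
(`Torus.realTrigPoly_gevreyLevel_freqBall_le`); a jointly smooth field attains its initial slice in
`L²` and `Ḣ¹` (`Torus.IsSmoothSpaceTimeOn.tendsto_integral_norm_sub_sq_nhdsGT`,
`….tendsto_gradNormSq_sub_nhdsGT`); the truncations `P_N v₀` of `v₀ ∈ H¹` converge in
`L² ∩ Ḣ¹` and are `H¹`-Cauchy with the explicit modulus (`Torus.tendsto_h1Err_fourierTruncate`,
`Torus.h1DistSq_fourierTruncate_le`).

Tree search: reused `Torus.integral_norm_sub_sq_le_two_mul`, `Torus.h1DistSq_le_two_mul`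
(`TorusH1DistanceBounds`), `Torus.eq_zero_of_integral_norm_sq_nonpos`,
`Torus.tendsto_integral_norm_sub_sq_of_uniform` (`TorusClassicalNSUniqueness`),
`Torus.IsSmoothSpaceTimeOn.continuousOn_gradNormSq`, `Torus.mFourierCoeff_complexify_sub`,
`Torus.eGradNormSq_sub_le`, `Torus.tendsto_lintegral_enorm_sq_fourierTruncate_sub`,
`Torus.tendsto_eGradNormSq_fourierTruncate_sub`, `Torus.eGradNormSq_eq_add_fourierTruncate`,
`Torus.mFourierCoeff_realTrigPoly_eq_zero_of_not_mem`; Mathlib `ge_of_tendsto'`.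

References: J. C. Robinson, J. L. Rodrigo, W. Sadowski, *The Three-Dimensional Navier–Stokes
Equations*, CUP 2016, Lemma 4.1, Thm 6.8, Thm 7.5. [RobinsonRodrigoSadowskiCUP2016]
-/

noncomputable section

open MeasureTheory Set Function Filter UnitAddTorus
open scoped ContDiff InnerProductSpace Topology ENNReal

namespace Literature.Analysis.FluidPDE

open Literature.Analysis.FunctionSpaces

variable {d : Type*} [Fintype d] [DecidableEq d]

/-! ### Uniqueness and rates for smooth `L²` / `H¹` limits -/

omit [DecidableEq d] in
/-- **Two smooth `L²`-limits of one sequence of smooth fields coincide** (parallelogram bound and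
`Torus.eq_zero_of_integral_norm_sq_nonpos`). [folklore] -/
theorem Torus.eq_of_tendsto_integral_norm_sub_sq {v : ℕ → UnitAddTorus d → EuclideanSpace ℝ d}
    {w w' : UnitAddTorus d → EuclideanSpace ℝ d} (hv : ∀ n, Torus.IsSmooth (v n))
    (hw : Torus.IsSmooth w) (hw' : Torus.IsSmooth w')
    (h : Tendsto (fun n => ∫ x, ‖v n x - w x‖ ^ 2) atTop (𝓝 0))
    (h' : Tendsto (fun n => ∫ x, ‖v n x - w' x‖ ^ 2) atTop (𝓝 0)) : w = w' := by
  have hle : ∀ n, ∫ x, ‖w x - w' x‖ ^ 2 ≤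
      2 * (∫ x, ‖w x - v n x‖ ^ 2) + 2 * ∫ x, ‖v n x - w' x‖ ^ 2 := fun n =>
    Torus.integral_norm_sub_sq_le_two_mul hw.continuous (hv n).continuous hw'.continuous
  have h1 : Tendsto (fun n => ∫ x, ‖w x - v n x‖ ^ 2) atTop (𝓝 0) := by
    refine h.congr fun n => ?_
    exact Torus.integral_norm_sub_sq_comm _ _
  have hlim : Tendsto (fun n => 2 * (∫ x, ‖w x - v n x‖ ^ 2) + 2 * ∫ x, ‖v n x - w' x‖ ^ 2)
      atTop (𝓝 0) := by
    simpa using (h1.const_mul 2).add (h'.const_mul 2)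
  have h0 : ∫ x, ‖w x - w' x‖ ^ 2 ≤ 0 := ge_of_tendsto' hlim hle
  exact sub_eq_zero.1 (Torus.eq_zero_of_integral_norm_sq_nonpos (v := w - w') (hw.sub hw') h0)

/-- **A pairwise `H¹` bound passes to a smooth `H¹`-limit.** If `d(b, cₘ)² ≤ B + δₘ` with `δₘ → 0`
and `cₘ → w` in `L²` and `Ḣ¹`, all fields smooth, then `d(b, w)² ≤ 2B`
(`d(v, w)² = ∫ ‖v − w‖² + ‖∇(v − w)‖₂²`; parallelogram bound and passage to the limit).
[folklore] -/
theorem Torus.h1DistSq_le_of_tendsto {b w : UnitAddTorus d → EuclideanSpace ℝ d}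
    {c : ℕ → UnitAddTorus d → EuclideanSpace ℝ d} (hb : Torus.IsSmooth b)
    (hc : ∀ m, Torus.IsSmooth (c m)) (hw : Torus.IsSmooth w) {B : ℝ} {δ : ℕ → ℝ}
    (hpair : ∀ m, (∫ x, ‖b x - c m x‖ ^ 2) + Torus.gradNormSq (fun x => b x - c m x) ≤ B + δ m)
    (hδ : Tendsto δ atTop (𝓝 0)) (hL2 : Tendsto (fun m => ∫ x, ‖c m x - w x‖ ^ 2) atTop (𝓝 0))
    (hH1 : Tendsto (fun m => Torus.gradNormSq (fun x => c m x - w x)) atTop (𝓝 0)) :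
    (∫ x, ‖b x - w x‖ ^ 2) + Torus.gradNormSq (fun x => b x - w x) ≤ 2 * B := by
  have hle : ∀ m, (∫ x, ‖b x - w x‖ ^ 2) + Torus.gradNormSq (fun x => b x - w x) ≤
      2 * (B + δ m) + 2 * ((∫ x, ‖c m x - w x‖ ^ 2) + Torus.gradNormSq (fun x => c m x - w x)) :=
    fun m => (Torus.h1DistSq_le_two_mul hb (hc m) hw).trans (by linarith [hpair m])
  have hlim : Tendsto (fun m => 2 * (B + δ m) +
      2 * ((∫ x, ‖c m x - w x‖ ^ 2) + Torus.gradNormSq (fun x => c m x - w x))) atTop (𝓝 (2 * B)) := by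
    have h := ((tendsto_const_nhds (x := B)).add hδ).const_mul 2 |>.add ((hL2.add hH1).const_mul 2)
    simpa using h
  exact ge_of_tendsto' hlim hle

/-- Weighted parallelogram bound for the gradient seminorm of smooth fields:
`ε‖∇(f + g)‖₂² ≤ ε(1 + ε)‖∇f‖₂² + (1 + ε)‖∇g‖₂²` for `ε ≥ 0` (pointwise
`2ε‖a‖‖b‖ ≤ ε²‖a‖² + ‖b‖²`, summed over the partial derivatives and integrated). [folklore] -/
theorem Torus.mul_gradNormSq_add_le {f g : UnitAddTorus d → EuclideanSpace ℝ d} (hf : Torus.IsSmooth f)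
    (hg : Torus.IsSmooth g) {ε : ℝ} (hε : 0 ≤ ε) :
    ε * Torus.gradNormSq (f + g) ≤
      ε * (1 + ε) * Torus.gradNormSq f + (1 + ε) * Torus.gradNormSq g := by
  -- adapted from `Torus.gradNormSq_add_le` (`TorusConvectionLaplacianNormSq`)
  have hf1 : Torus.IsContDiff 1 f := hf.isContDiff (by simp)
  have hg1 : Torus.IsContDiff 1 g := hg.isContDiff (by simp)
  have hif : Integrable (fun x => ∑ i, ‖Torus.partialDeriv i f x‖ ^ 2) volume :=
    integrable_finsetSum _ fun i _ => ((hf.partialDeriv i).norm_sq).integrable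
  have hig : Integrable (fun x => ∑ i, ‖Torus.partialDeriv i g x‖ ^ 2) volume :=
    integrable_finsetSum _ fun i _ => ((hg.partialDeriv i).norm_sq).integrable
  have hifg : Integrable (fun x => ∑ i, ‖Torus.partialDeriv i (f + g) x‖ ^ 2) volume :=
    integrable_finsetSum _ fun i _ => (((hf.add hg).partialDeriv i).norm_sq).integrable
  have hsq : ∀ p q : EuclideanSpace ℝ d,
      ε * ‖p + q‖ ^ 2 ≤ ε * (1 + ε) * ‖p‖ ^ 2 + (1 + ε) * ‖q‖ ^ 2 := fun p q => by
    have h1 : ‖p + q‖ ^ 2 ≤ (‖p‖ + ‖q‖) ^ 2 := pow_le_pow_left₀ (norm_nonneg _) (norm_add_le p q) 2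
    have h2 : ε * ‖p + q‖ ^ 2 ≤ ε * (‖p‖ + ‖q‖) ^ 2 := mul_le_mul_of_nonneg_left h1 hε
    nlinarith [sq_nonneg (ε * ‖p‖ - ‖q‖)]
  have hpt : ∀ x, ε * ∑ i, ‖Torus.partialDeriv i (f + g) x‖ ^ 2 ≤
      ε * (1 + ε) * ∑ i, ‖Torus.partialDeriv i f x‖ ^ 2 +
        (1 + ε) * ∑ i, ‖Torus.partialDeriv i g x‖ ^ 2 := by
    intro x
    rw [Finset.mul_sum, Finset.mul_sum, Finset.mul_sum, ← Finset.sum_add_distrib]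
    refine Finset.sum_le_sum fun i _ => ?_
    rw [Torus.partialDeriv_add hf1 hg1 i, Pi.add_apply]
    exact hsq _ _
  calc ε * Torus.gradNormSq (f + g) = ∫ x, ε * ∑ i, ‖Torus.partialDeriv i (f + g) x‖ ^ 2 := by
        rw [Torus.gradNormSq, integral_const_mul]
    _ ≤ ∫ x, (ε * (1 + ε) * ∑ i, ‖Torus.partialDeriv i f x‖ ^ 2 +
          (1 + ε) * ∑ i, ‖Torus.partialDeriv i g x‖ ^ 2) :=
        integral_mono (hifg.const_mul ε) ((hif.const_mul _).add (hig.const_mul _)) hpt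
    _ = ε * (1 + ε) * Torus.gradNormSq f + (1 + ε) * Torus.gradNormSq g := by
        rw [integral_add (hif.const_mul _) (hig.const_mul _), integral_const_mul, integral_const_mul]
        rfl

/-- **An enstrophy bound passes to `H¹`-limits**: if `‖∇cₘ‖₂² ≤ M` for all `m` and
`‖∇(cₘ − w)‖₂² → 0`, all fields smooth, then `‖∇w‖₂² ≤ M` (`Torus.mul_gradNormSq_add_le` with
`w = cₘ + (w − cₘ)`, `m → ∞`, then `ε → 0⁺`). [folklore] -/
theorem Torus.gradNormSq_le_of_tendsto {c : ℕ → UnitAddTorus d → EuclideanSpace ℝ d}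
    {w : UnitAddTorus d → EuclideanSpace ℝ d} (hc : ∀ m, Torus.IsSmooth (c m)) (hw : Torus.IsSmooth w)
    {M : ℝ} (hM : ∀ m, Torus.gradNormSq (c m) ≤ M)
    (hH1 : Tendsto (fun m => Torus.gradNormSq (fun x => c m x - w x)) atTop (𝓝 0)) :
    Torus.gradNormSq w ≤ M := by
  have hM0 : 0 ≤ M := (Torus.gradNormSq_nonneg _).trans (hM 0)
  have hH1' : Tendsto (fun m => Torus.gradNormSq (fun x => w x - c m x)) atTop (𝓝 0) := by
    refine hH1.congr fun m => ?_
    exact Torus.gradNormSq_sub_comm _ _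
  -- for every `ε > 0`: `ε‖∇w‖² ≤ ε(1+ε)M`
  have hε : ∀ ε : ℝ, 0 < ε → Torus.gradNormSq w ≤ (1 + ε) * M := by
    intro ε hε
    have hle : ∀ m, ε * Torus.gradNormSq w ≤
        ε * (1 + ε) * M + (1 + ε) * Torus.gradNormSq (fun x => w x - c m x) := by
      intro m
      have h := Torus.mul_gradNormSq_add_le (hc m) (hw.sub (hc m)) hε.le (f := c m)
        (g := fun x => w x - c m x)
      have he : (c m + fun x => w x - c m x) = w := by
        funext x
        simp
      rw [he] at h
      have h2 : ε * (1 + ε) * Torus.gradNormSq (c m) ≤ ε * (1 + ε) * M :=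
        mul_le_mul_of_nonneg_left (hM m) (by positivity)
      linarith
    have hlim : Tendsto (fun m => ε * (1 + ε) * M + (1 + ε) * Torus.gradNormSq (fun x => w x - c m x))
        atTop (𝓝 (ε * (1 + ε) * M)) := by
      simpa using (hH1'.const_mul (1 + ε)).const_add (ε * (1 + ε) * M)
    have h := ge_of_tendsto' hlim hle
    have h' : ε * Torus.gradNormSq w ≤ ε * ((1 + ε) * M) := by linarith
    exact le_of_mul_le_mul_left h' hε
  -- let `ε → 0⁺`
  have hlim : Tendsto (fun ε : ℝ => (1 + ε) * M) (𝓝[>] 0) (𝓝 M) := by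
    have h : Tendsto (fun ε : ℝ => (1 + ε) * M) (𝓝 0) (𝓝 ((1 + 0) * M)) :=
      ((continuous_const.add continuous_id).mul continuous_const).tendsto 0
    rw [add_zero, one_mul] at h
    exact h.mono_left nhdsWithin_le_nhds
  exact ge_of_tendsto hlim (eventually_nhdsWithin_of_forall fun ε hε0 => hε ε hε0)

/-! ### Weighted Fourier sums of differences; Gevrey levels of trigonometric polynomials -/

omit [DecidableEq d] in
/-- Parallelogram bound for weighted Fourier sums of a difference of integrable fields:
`∑_{k∈S} wₖ‖𝓕(u − w)(k)‖² ≤ 2∑_{k∈S} wₖ‖𝓕u(k)‖² + 2∑_{k∈S} wₖ‖𝓕w(k)‖²` (weights `w ≥ 0`). [folklore] -/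
theorem Torus.sum_mul_norm_sq_mFourierCoeff_sub_le {u w : UnitAddTorus d → EuclideanSpace ℝ d}
    (hu : Integrable u volume) (hw : Integrable w volume) {wt : (d → ℤ) → ℝ} (hwt : ∀ k, 0 ≤ wt k)
    (S : Finset (d → ℤ)) :
    ∑ k ∈ S, wt k * ‖mFourierCoeff (EuclideanSpace.complexify ∘ fun y => u y - w y) k‖ ^ 2 ≤
      2 * ∑ k ∈ S, wt k * ‖mFourierCoeff (EuclideanSpace.complexify ∘ u) k‖ ^ 2 +
        2 * ∑ k ∈ S, wt k * ‖mFourierCoeff (EuclideanSpace.complexify ∘ w) k‖ ^ 2 := by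
  rw [Finset.mul_sum, Finset.mul_sum, ← Finset.sum_add_distrib]
  refine Finset.sum_le_sum fun k _ => ?_
  have hk : mFourierCoeff (EuclideanSpace.complexify ∘ fun y => u y - w y) k =
      mFourierCoeff (EuclideanSpace.complexify ∘ u) k - mFourierCoeff (EuclideanSpace.complexify ∘ w) k :=
    Torus.mFourierCoeff_complexify_sub hu hw k
  rw [hk]
  set a := mFourierCoeff (EuclideanSpace.complexify ∘ u) k
  set b := mFourierCoeff (EuclideanSpace.complexify ∘ w) k
  have h1 : ‖a - b‖ ^ 2 ≤ 2 * ‖a‖ ^ 2 + 2 * ‖b‖ ^ 2 := by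
    have h := norm_sub_le a b
    nlinarith [norm_nonneg (a - b), norm_nonneg a, norm_nonneg b, sq_nonneg (‖a‖ - ‖b‖)]
  have h2 := mul_le_mul_of_nonneg_left h1 (hwt k)
  linarith

/-- **Gevrey levels of a real trigonometric polynomial are finite sums**: `realTrigPoly S c` is
band-limited to `S ∪ −S` (`Torus.mFourierCoeff_realTrigPoly_eq_zero_of_not_mem`), so
`∑_{|k| ≤ R} e^{2τ|k|}|k|²‖𝓕(realTrigPoly S c)(k)‖²` is at most the same finite sum over `S ∪ −S`,
for every `R`. [folklore] -/
theorem Torus.realTrigPoly_gevreyLevel_freqBall_le (S : Finset (d → ℤ)) (c : (d → ℤ) → EuclideanSpace ℂ d)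
    (τ : ℝ) (R : ℕ) :
    ∑ k ∈ Torus.freqBall R, Real.exp (τ * Real.sqrt (Torus.freqNormSq k)) ^ 2 *
        (Torus.freqNormSq k * ‖mFourierCoeff (EuclideanSpace.complexify ∘ Torus.realTrigPoly S c) k‖ ^ 2) ≤
      ∑ k ∈ S ∪ S.image (fun k => -k), Real.exp (τ * Real.sqrt (Torus.freqNormSq k)) ^ 2 *
        (Torus.freqNormSq k * ‖mFourierCoeff (EuclideanSpace.complexify ∘ Torus.realTrigPoly S c) k‖ ^ 2) := by
  -- adapted from `force_gevreyLevel_freqBall_le` (Summit file `…ErgodicPhaseGevrey`), general `d`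
  classical
  set g : (d → ℤ) → ℝ := fun k => Real.exp (τ * Real.sqrt (Torus.freqNormSq k)) ^ 2 *
    (Torus.freqNormSq k * ‖mFourierCoeff (EuclideanSpace.complexify ∘ Torus.realTrigPoly S c) k‖ ^ 2)
    with hg
  have hg0 : ∀ k, 0 ≤ g k := fun k =>
    mul_nonneg (sq_nonneg _) (mul_nonneg (Torus.freqNormSq_nonneg k) (sq_nonneg _))
  have hzero : ∀ k, k ∉ S ∪ S.image (fun k => -k) → g k = 0 := fun k hk => by
    have hk1 : k ∉ S := fun h1 => hk (Finset.mem_union_left _ h1)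
    have hk2 : -k ∉ S := fun h2 =>
      hk (Finset.mem_union_right _ (Finset.mem_image.2 ⟨-k, h2, neg_neg k⟩))
    have h0 : mFourierCoeff (EuclideanSpace.complexify ∘ Torus.realTrigPoly S c) k = 0 :=
      Torus.mFourierCoeff_realTrigPoly_eq_zero_of_not_mem _ hk1 hk2
    simp only [hg, h0, norm_zero]
    ring
  calc ∑ k ∈ Torus.freqBall R, g k = ∑ k ∈ Torus.freqBall R ∩ (S ∪ S.image (fun k => -k)), g k :=
        (Finset.sum_subset Finset.inter_subset_left fun k hkB hknot =>
          hzero k fun hkT => hknot (Finset.mem_inter.2 ⟨hkB, hkT⟩)).symm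
    _ ≤ ∑ k ∈ S ∪ S.image (fun k => -k), g k :=
        Finset.sum_le_sum_of_subset_of_nonneg Finset.inter_subset_right fun k _ _ => hg0 k

/-! ### Attainment of the initial slice by jointly smooth fields -/

omit [DecidableEq d] in
/-- A jointly smooth field on `[a, b] × T^d`, `a < b`, attains its initial slice in `L²`:
`∫ ‖u(t) − u(a)‖² → 0` as `t → a⁺`. [folklore] -/
theorem _root_.Literature.Analysis.FunctionSpaces.Torus.IsSmoothSpaceTimeOn.tendsto_integral_norm_sub_sq_nhdsGT
    {a b : ℝ} {u : ℝ → UnitAddTorus d → EuclideanSpace ℝ d} (hu : Torus.IsSmoothSpaceTimeOn (Icc a b) u)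
    (hab : a < b) : Tendsto (fun t => ∫ x, ‖u t x - u a x‖ ^ 2) (𝓝[>] a) (𝓝 0) := by
  have hle : 𝓝[>] a ≤ 𝓝[Icc a b] a := nhdsWithin_le_iff.2 (Icc_mem_nhdsGT hab)
  have h := Torus.tendsto_integral_norm_sub_sq_of_uniform (u₁ := fun _ => u a) hu hab fun ε hε =>
    Eventually.of_forall fun t x => by simpa using hε.le
  refine h.congr fun t => ?_
  exact Torus.integral_norm_sub_sq_comm _ _

/-- A jointly smooth field on `[a, b] × T^d`, `a < b`, attains its initial slice in `Ḣ¹`: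
`‖∇(u(t) − u(a))‖₂² → 0` as `t → a⁺` (continuity of `t ↦ ‖∇(u(t) − u(a))‖₂²` on `[a, b]`,
`Torus.IsSmoothSpaceTimeOn.continuousOn_gradNormSq`). [folklore] -/
theorem _root_.Literature.Analysis.FunctionSpaces.Torus.IsSmoothSpaceTimeOn.tendsto_gradNormSq_sub_nhdsGT
    {a b : ℝ} {u : ℝ → UnitAddTorus d → EuclideanSpace ℝ d} (hu : Torus.IsSmoothSpaceTimeOn (Icc a b) u)
    (hab : a < b) : Tendsto (fun t => Torus.gradNormSq (fun x => u t x - u a x)) (𝓝[>] a) (𝓝 0) := by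
  have ha : a ∈ Icc a b := ⟨le_rfl, hab.le⟩
  have hw : Torus.IsSmoothSpaceTimeOn (Icc a b) (fun t x => u t x - u a x) :=
    hu.sub (Torus.isSmoothSpaceTimeOn_const (hu.isSmooth_slice ha) _)
  have hc := hw.continuousOn_gradNormSq (convex_Icc a b) (uniqueDiffOn_Icc hab) a ha
  have h0 : Torus.gradNormSq (fun x => u a x - u a x) = 0 := by
    unfold Torus.gradNormSq
    have hpd : ∀ (i : d) (x : UnitAddTorus d),
        Torus.partialDeriv i (fun _ : UnitAddTorus d => (0 : EuclideanSpace ℝ d)) x = 0 := by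
      intro i x
      change deriv (fun _ : ℝ => (0 : EuclideanSpace ℝ d)) 0 = 0
      simp
    simp only [sub_self]
    simp [hpd]
  have hle : 𝓝[>] a ≤ 𝓝[Icc a b] a := nhdsWithin_le_iff.2 (Icc_mem_nhdsGT hab)
  have h := (hc.tendsto).mono_left hle
  rwa [h0] at h

/-! ### Truncations of `H¹` data: convergence and the Cauchy modulus -/

omit [DecidableEq d] in
/-- Parallelogram bound in `L²` for square-integrable fields:
`∫ ‖f − h‖² ≤ 2∫ ‖f − g‖² + 2∫ ‖g − h‖²`. [folklore] -/
theorem Torus.integral_norm_sub_sq_le_two_mul_of_memLp {f g h : UnitAddTorus d → EuclideanSpace ℝ d}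
    (hf : MemLp f 2 volume) (hg : MemLp g 2 volume) (hh : MemLp h 2 volume) :
    ∫ x, ‖f x - h x‖ ^ 2 ≤ 2 * (∫ x, ‖f x - g x‖ ^ 2) + 2 * ∫ x, ‖g x - h x‖ ^ 2 := by
  have hi : ∀ {φ : UnitAddTorus d → EuclideanSpace ℝ d}, MemLp φ 2 volume →
      Integrable (fun x => ‖φ x‖ ^ 2) volume := fun hφ => (memLp_two_iff_integrable_sq_norm hφ.1).1 hφ
  have hiA := hi (hf.sub hg)
  have hiB := hi (hg.sub hh)
  have hiC := hi (hf.sub hh)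
  simp only [Pi.sub_apply] at hiA hiB hiC
  have hpt : ∀ x, ‖f x - h x‖ ^ 2 ≤ 2 * ‖f x - g x‖ ^ 2 + 2 * ‖g x - h x‖ ^ 2 := fun x => by
    have hx : ‖f x - h x‖ ≤ ‖f x - g x‖ + ‖g x - h x‖ := norm_sub_le_norm_sub_add_norm_sub _ _ _
    have hx2 : ‖f x - h x‖ ^ 2 ≤ (‖f x - g x‖ + ‖g x - h x‖) ^ 2 :=
      pow_le_pow_left₀ (norm_nonneg _) hx 2
    nlinarith [sq_nonneg (‖f x - g x‖ - ‖g x - h x‖)]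
  calc ∫ x, ‖f x - h x‖ ^ 2 ≤ ∫ x, (2 * ‖f x - g x‖ ^ 2 + 2 * ‖g x - h x‖ ^ 2) :=
        integral_mono hiC ((hiA.const_mul 2).add (hiB.const_mul 2)) hpt
    _ = 2 * (∫ x, ‖f x - g x‖ ^ 2) + 2 * ∫ x, ‖g x - h x‖ ^ 2 := by
        rw [integral_add (hiA.const_mul 2) (hiB.const_mul 2), integral_const_mul, integral_const_mul]

/-- The `Ḣ¹` truncation error of a finite-enstrophy field is finite:
`‖∇(P_N v − v)‖₂² ≤ ‖∇v‖₂² < ∞` (spectral Pythagoras). [folklore] -/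
theorem Torus.eGradNormSq_fourierTruncate_sub_ne_top {v : UnitAddTorus d → EuclideanSpace ℝ d}
    (hv : Integrable v volume) (hH : Torus.eGradNormSq v ≠ ⊤) (N : ℕ) :
    Torus.eGradNormSq (Torus.fourierTruncate N v - v) ≠ ⊤ := by
  refine ne_top_of_le_ne_top hH ?_
  rw [Torus.eGradNormSq_eq_add_fourierTruncate hv N]
  exact le_add_self

/-- **The truncations of `v₀ ∈ H¹` converge in `L² ∩ Ḣ¹`**:
`∫ ‖P_N v₀ − v₀‖² + ‖∇(P_N v₀ − v₀)‖₂² → 0` (the `Ḣ¹` error read in `ℝ`; Robinson–Rodrigo–Sadowski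
2016, Lemma 4.1). [cite: RobinsonRodrigoSadowskiCUP2016, Lemma 4.1] -/
theorem Torus.tendsto_h1Err_fourierTruncate {v : UnitAddTorus d → EuclideanSpace ℝ d}
    (hv : MemLp v 2 volume) (hH : Torus.eGradNormSq v ≠ ⊤) :
    Tendsto (fun N => (∫ x, ‖Torus.fourierTruncate N v x - v x‖ ^ 2) +
      (Torus.eGradNormSq (Torus.fourierTruncate N v - v)).toReal) atTop (𝓝 0) := by
  have hvi : Integrable v volume := hv.integrable one_le_two
  -- the `L²` part
  have h1 : Tendsto (fun N => ∫ x, ‖Torus.fourierTruncate N v x - v x‖ ^ 2) atTop (𝓝 0) := by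
    have h := (ENNReal.tendsto_toReal ENNReal.zero_ne_top).comp
      (Torus.tendsto_lintegral_enorm_sq_fourierTruncate_sub hv)
    rw [ENNReal.toReal_zero] at h
    refine h.congr fun N => ?_
    have hsub : MemLp (fun x => Torus.fourierTruncate N v x - v x) 2 volume :=
      (Torus.memLp_fourierTruncate N v 2).sub hv
    rw [Function.comp_apply, ← Torus.ofReal_integral_norm_sq_eq_lintegral hsub,
      ENNReal.toReal_ofReal (integral_nonneg fun x => sq_nonneg _)]
  -- the `Ḣ¹` part
  have h2 : Tendsto (fun N => (Torus.eGradNormSq (Torus.fourierTruncate N v - v)).toReal) atTop (𝓝 0) := by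
    have h := (ENNReal.tendsto_toReal ENNReal.zero_ne_top).comp
      (Torus.tendsto_eGradNormSq_fourierTruncate_sub hv hH.lt_top)
    rwa [ENNReal.toReal_zero] at h
  simpa using h1.add h2

/-- **The truncations of `v₀ ∈ H¹` are `H¹`-Cauchy with the explicit modulus**: with
`ε_N = ∫ ‖P_N v₀ − v₀‖² + ‖∇(P_N v₀ − v₀)‖₂²`,
`∫ ‖P_N v₀ − P_M v₀‖² + ‖∇(P_N v₀ − P_M v₀)‖₂² ≤ 2ε_N + 2ε_M` (parallelogram bounds in `L²` and,
spectrally, in `Ḣ¹`; the difference of truncations is smooth, so its classical and spectral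
gradient norms agree). [folklore] -/
theorem Torus.h1DistSq_fourierTruncate_le {v : UnitAddTorus d → EuclideanSpace ℝ d}
    (hv : MemLp v 2 volume) (hH : Torus.eGradNormSq v ≠ ⊤) (N M : ℕ) :
    (∫ x, ‖Torus.fourierTruncate N v x - Torus.fourierTruncate M v x‖ ^ 2) +
        Torus.gradNormSq (fun x => Torus.fourierTruncate N v x - Torus.fourierTruncate M v x) ≤
      2 * ((∫ x, ‖Torus.fourierTruncate N v x - v x‖ ^ 2) +
          (Torus.eGradNormSq (Torus.fourierTruncate N v - v)).toReal) +
        2 * ((∫ x, ‖Torus.fourierTruncate M v x - v x‖ ^ 2) +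
          (Torus.eGradNormSq (Torus.fourierTruncate M v - v)).toReal) := by
  have hvi : Integrable v volume := hv.integrable one_le_two
  have hN := Torus.isSmooth_fourierTruncate N v
  have hM := Torus.isSmooth_fourierTruncate M v
  -- `L²`
  have hL2 := Torus.integral_norm_sub_sq_le_two_mul_of_memLp (hN.memLp 2) hv (hM.memLp 2)
    (f := Torus.fourierTruncate N v) (g := v) (h := Torus.fourierTruncate M v)
  have hL2' : ∫ x, ‖v x - Torus.fourierTruncate M v x‖ ^ 2 =
      ∫ x, ‖Torus.fourierTruncate M v x - v x‖ ^ 2 := Torus.integral_norm_sub_sq_comm _ _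
  -- `Ḣ¹`, spectrally
  have hfinN := Torus.eGradNormSq_fourierTruncate_sub_ne_top hvi hH N
  have hfinM := Torus.eGradNormSq_fourierTruncate_sub_ne_top hvi hH M
  have hiN : Integrable (Torus.fourierTruncate N v - v) volume := hN.integrable.sub hvi
  have hiM : Integrable (Torus.fourierTruncate M v - v) volume := hM.integrable.sub hvi
  have hsp := Torus.eGradNormSq_sub_le hiN hiM
  have he : Torus.fourierTruncate N v - v - (Torus.fourierTruncate M v - v) =
      Torus.fourierTruncate N v - Torus.fourierTruncate M v := by
    funext x
    simp
  rw [he] at hsp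
  have hH1 : Torus.gradNormSq (fun x => Torus.fourierTruncate N v x - Torus.fourierTruncate M v x) ≤
      2 * (Torus.eGradNormSq (Torus.fourierTruncate N v - v)).toReal +
        2 * (Torus.eGradNormSq (Torus.fourierTruncate M v - v)).toReal := by
    rw [show (fun x => Torus.fourierTruncate N v x - Torus.fourierTruncate M v x) =
        Torus.fourierTruncate N v - Torus.fourierTruncate M v from rfl,
      Torus.gradNormSq_eq_toReal_eGradNormSq_holds (hN.sub hM)]
    have hfin : 2 * Torus.eGradNormSq (Torus.fourierTruncate N v - v) +
        2 * Torus.eGradNormSq (Torus.fourierTruncate M v - v) ≠ ⊤ :=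
      ENNReal.add_ne_top.2 ⟨ENNReal.mul_ne_top ENNReal.ofNat_ne_top hfinN,
        ENNReal.mul_ne_top ENNReal.ofNat_ne_top hfinM⟩
    have h := ENNReal.toReal_mono hfin hsp
    rw [ENNReal.toReal_add (ENNReal.mul_ne_top ENNReal.ofNat_ne_top hfinN)
      (ENNReal.mul_ne_top ENNReal.ofNat_ne_top hfinM), ENNReal.toReal_mul, ENNReal.toReal_mul,
      ENNReal.toReal_ofNat] at h
    exact h
  linarith

end Literature.Analysis.FluidPDE

end
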